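import Summits.QuantumFields.BalabanUV.T4Continuum.Spine.NE1p.DressedSmallFieldComponentCount

/-!
# T⁴ programme, spine estimate NE1′ (node O3b/H2) — N0w's CREW COMPLEMENT, PART 1: SEVERAL COMPONENTS PER MEMBER — the inner datum
# of a scale-`(k+1)` member `Z′_i` is a NONEMPTY finite SET of anchored scale-`k` components with inner labels ([Balaban1988RGII] p. 19
# «A sum over n components is estimated by a product of n sums», p. 20 «For n > 1 we leave only one exponential … The sum over n ≥ 1 is
# now bounded by 2(L+2)⁴O(1)ε₂», KIND); the member bound is N0w's `memberSum_le_of_anchor` ∘ `Π(1 + w) − 1 ≤ x·e^{x}`, and N0v's END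
# `attachedPart_locE_le_of_coresAt_pencil_outerLabels` is fired ONCE at the set-valued inner data (N0w's END being the n = 1 sub-case)

Cell `pub-balaban`, sub-cell `t4`, BINDER-OWNERS row NE1′ (owner lineage t4-ne1p-p1, road P1 «RG-trajectory comparison … μ-uniformity
through the printed small-field bounds»); crew seat `b2b-balaban-t4-ne1p-formalise-leaf-01` (LEAF PROVER 01, generation 13); crew row
S41 ∕ DAG N29zzm, PART 1 of 2 (INTENT `CLAIMS.log` 2026-08-20 l.19296, RE-SCOPED l.19534 after the owner's INTENT N0w l.19521, BOOKED typer
R-T125 (iii) l.19575 subject to the owner's first refusal).  ADDITIVE — imports the owner's N0w `Spine/NE1p/DressedSmallFieldComponentCount`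
ONLY (→ N0v `DressedSmallFieldOuterCount` → N0u `DressedSmallFieldInnerCount` → N0t → N0s → N0r → …); THEOREMS ONLY (0 `def`, 0
`def … : Prop`, 0 cite); nothing of N0s ∕ N0u ∕ N0v ∕ N0w ∕ b13 is restated — `memberSum_le_of_anchor`,
`attachedPart_locE_le_of_coresAt_pencil_outerLabels` and the `Geometry` fields are used BY NAME, ONCE each.

WHY THIS FILE.  N0w discharges N0v's per-member inner bound `hmember` for inner data `κ Z′ := Σ _ : Dk.Dom, ι₀` — ONE scale-`k`
component `Z₀` with `cl Z₀ = Z′` and one of its inner labels per member.  Print's third resummation step sums over the components of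
`Z₀ = ∪Z_i` grouped by their closures `Z′_i`, SEVERAL components having the same closure (p. 19: «For each Z′_i we sum over all possible
components of Z₀ determining this Z′_i … the sum over the components can be decomposed into a sum over one component, plus a sum over two
components, and so on. A sum over n components is estimated by a product of n sums»; p. 20: «For n > 1 we leave only one exponential,
estimating by 1 the remaining ones with the same domain Z′_i. The sum over n ≥ 1 is now bounded by 2(L+2)⁴O(1)ε₂, assuming that
(L+2)⁴O(1)ε₂ ≤ ½»).  On the cell's format the member's inner datum is therefore a NONEMPTY FINITE SET `T` of pairs ⟨component, label⟩,
weight `Π_{j∈T} ε·m j.1 j.2` (a component may a priori occur in `T` with several labels — the bound below covers this LARGER index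
set, of which print's configurations «distinct components, one label each» are a sub-collection, admissible through `hadm`'s «any
sub-collection of terms»), and N0w's single-component member bound is the n = 1 sub-case:
* §1 `sum_powerset_nonempty_prod_le` [arith]: for nonnegative weights on a finite set `U`, `Σ_{∅≠T⊆U} Π_{j∈T} w_j = Π_{j∈U}(1 + w_j) − 1
  ≤ e^{x} − 1 ≤ x·e^{x}`, `x := Σ_U w` (`Finset.prod_one_add`, `Finset.sum_erase_eq_sub`, `Real.add_one_le_exp`) — print's factor `2`
  under its clause `x ≤ ½` replaced by the clause-free `e^{x}` (arithmetic; nothing of print asserted).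
* §2 `memberSetSum_le_of_anchor` (kernel): N0w's `memberSum_le_of_anchor` ONCE BY NAME — its binders VERBATIM (`hinner` N0u's inner-count
  SHAPE, `h126` the anchored (1.26)-KIND sums, `hanchor`∕`hA₀` the anchor, `htransfer` the (2.36)-KIND transfer, `hκR`∕`hrate` the rate
  split) plus `0 ≤ r`, `0 ≤ R`, `0 ≤ m` — then §1: over the nonempty sets of labels with closure `Z′` the weights sum to
  `≤ (A·e^{5R}·e^{A})·e^{−r d(Z′)}·e^{−R(d(Z′)+5)}`, `A := ε·e^{c₀}·A₀·K₀` (the single-component bound `x ≤ A·e^{5R}·e^{−r d}·e^{−R(d+5)}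
  and its size-free form `x ≤ A`).
* §3 END **`attachedPart_locE_le_of_coresAt_pencil_componentSets`** (kernel): N0v's `attachedPart_locE_le_of_coresAt_pencil_outerLabels`
  ONCE BY NAME at the inner-datum type `Finset (Σ _ : Dk.Dom, ι₀)`, `J Z′ :=` the NONEMPTY subsets of `(univ.filter (cl · = Z′)).sigma I`,
  `n Z′ T := Π_{j∈T} ε·m j.1 j.2`, `hmember` SUPPLIED by §2; binders = N0w's END `attachedPart_locE_le_of_coresAt_pencil_components`
  VERBATIM except `hadm`'s member-wise NONEMPTY-SUBSET clause, `hAmp`'s set-product majorant `v^{#W′}·Π_{Z′∈F} Π_{j ∈ p Z′} ε·m j.1 j.2`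
  and N0v's (2.29) clause `h229` at the amplitude `A·e^{5R}·e^{A}`; `0 ≤ Aₐ`∕`0 ≤ a`∕`0 ≤ r`∕`0 ≤ R` DERIVED (`hA` at `X₀`, `hκ`,
  `hrate`∕`hRR` as in N0v).  PART 2 `DressedSmallFieldComponentInner` SUPPLIES `hinner` from N0u's `innerCount_le_decay` for N0u's own
  labels and fires N0w's END and this END with it.

PRINTED LOCI (TYPE ∕ CONTEXT only — the audited manuscript [Balaban1988RGII] = CMP 116 (1988) 1–22, renders
`b2b-balaban-ref1/pages/1988-cmp116-rg-II-cluster/…-p008∕p019∕p020-x2.png` read as images this generation; nothing below is used as a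
fact about Bałaban's densities): p. 19 ¶ after (2.35) and (2.36), p. 20 ll. 1–6 (quoted above and in N0w's header); p. 8 (1.26) «Σ_{X∈𝐃_j,
X⊃□′} exp(−κd_j(X)) ≤ O(1), for κ sufficiently large» and (1.28) «M⁻⁴|Y| ≤ 3·2³d_k(Y) ≤ exp(1∕16)(κ₁−2)d_k(Y)».  LOCATING NOTE (a reading of
the locus, forwarded to the referees by typer R-T125; asserting nothing of print): p. 19's «using (1.28), with κ replaced by δκ» invokes
the (1.26)-KIND sum over the domains containing a cube — which N0w types as `Gk.ineq126` BY NAME; (1.28) as printed is the volume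
inequality.
WHAT STAYS DISPLAYED (binders, by name; NOTHING instantiated on Bałaban's densities): everything N0w's END displays — `hroom`,
`hm`∕`hN`∕`hq`, `hO`∕`hH`, (B1b)'s residue `terms`∕`emb`∕`hscale`∕`hact`, `hadm` (terms of `Z` = outer labels whose inner data are
nonempty sets of ⟨component with closure `Z′`, label⟩ — (B1b)∕(2.35) READING), the components' inner-count SHAPE `hinner` (N0u's
currency; PART 2 supplies it), the closure `cl` and anchor `anc`∕`hanchor`∕`hA` (p. 19–20 KIND; displayed here over an ABSTRACT `Gk` — on pv22's nested tori
they are crew row S44's business), the (2.36)-KIND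
transfer `htransfer` (factor `ℓ` a binder — print's `½L`, the tree's repaired `L∕a_L`, GAPS G-B13-09R; NO numeral), N0v's (2.27)∘(2.37)-KIND
link `hlink` and `hRR`, (B3-amp) `hAmp`, the (2.29) clauses `hκ`∕`h229` at scale `k+1`, the rate bookkeeping `hκR`∕`hrate2` — (B5)-KIND
arithmetic on displayed letters whose standing against print's δ, κ, κ₁, α₆, L, M is NOT asserted.  WHAT IT SAYS FOR THE WALL (the
owner's reading, Q47 RULED T4-DAG v45 §8 «v1.8-proposed»; nothing re-labelled here): the third step's «n ≥ 1 components per Z′_i» is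
kernel arithmetic on top of N0w; (B3-count)'s DISPLAYED items are unchanged in KIND (links ∕ transfer ∕ anchor ∕ N0u's `hinner` SHAPE —
the last one SUPPLIED in PART 2).  NOTHING of (B3) discharged on Bałaban's (2.14) densities; 0 binders instantiated on Bałaban's densities;
no wall item moves; wall v1.7 (T4-DAG v46) does NOT move; R-t4r2-Q2 NOT met thereby; NE1′ ⇐ the named binders — NOT printed, NOT proved;
spine PROVED 0∕9; count 9 unchanged.
HONEST FRAMING.  Finite sums + real arithmetic ([folklore]∕[arith]) and two by-name applications (N0w §2, N0v's END); the cores ∕ labels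
are the cell's typed FORMAT of (2.14) and of the resummation index, NOT Bałaban's functions; `G`∕`Gk` are HYPOTHESIS structures
(instances on pv22's tori are the cell's, not constructed here); the quotations above are LOCI of the audited manuscript, TYPE ∕ CONTEXT
only, never hypothesis-free facts; ABSOLUTE RULE honoured — nothing internally minted is cited, [folklore]∕[arith] tags on kernel lemmas
only.  Rung (B)+1 on ONE finite four-torus — NOT infinite volume, NOT a mass gap, NOT OS on ℝ⁴, NOT Clay.  HONEST DEPENDENCY: continuum YM
on T⁴ ⇐ BetaPertH ∧ nine spine estimates (0/9 proved); BetaPertH ⇐ (D1) ∧ (D4) ∧ CAP+tail; G-an2-4 gates asym, D1 and NE2/3/4.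
-/

noncomputable section

namespace Summit.QuantumFields.BalabanUV.T4Continuum.NE1p.DressedSmallFieldComponentSets

open scoped BigOperators
open Summit.QuantumFields.BalabanUV.T4Continuum.NE1p.DressedSmallFieldComponentCount (memberSum_le_of_anchor)

/-! ## §1 SEVERAL COMPONENTS PER MEMBER: the sum over the nonempty sub-products is `Π(1 + w) − 1 ≤ x·e^{x}` [arith] -/

/-- **«A SUM OVER n COMPONENTS IS ESTIMATED BY A PRODUCT OF n SUMS»** ([Balaban1988RGII] p. 19 bottom ∕ p. 20 top, KIND; here pure
arithmetic [arith]): for nonnegative weights `w` on a finite set `U` and `x := Σ_{j∈U} w_j`,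
`Σ_{∅ ≠ T ⊆ U} Π_{j∈T} w_j = Π_{j∈U}(1 + w_j) − 1 ≤ e^{x} − 1 ≤ x·e^{x}` (`Finset.prod_one_add`, `Real.add_one_le_exp`).  Print bounds
the same quantity by `2x` under its clause `x ≤ ½`; the clause-free factor `e^{x}` is used instead (nothing of print asserted). -/
theorem sum_powerset_nonempty_prod_le {ι : Type*} (U : Finset ι) (w : ι → ℝ) (hw : ∀ j ∈ U, 0 ≤ w j) :
    ∑ T ∈ U.powerset.filter (fun T => T.Nonempty), ∏ j ∈ T, w j ≤ (∑ j ∈ U, w j) * Real.exp (∑ j ∈ U, w j) := by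
  classical
  have hset : ∑ T ∈ U.powerset.filter (fun T => T.Nonempty), ∏ j ∈ T, w j = (∏ j ∈ U, (1 + w j)) - 1 := by
    rw [Finset.prod_one_add]
    have hE : U.powerset.filter (fun T => T.Nonempty) = U.powerset.erase ∅ := by
      ext T
      simp only [Finset.mem_filter, Finset.mem_erase, Finset.mem_powerset, Finset.nonempty_iff_ne_empty, ne_eq]
      tauto
    rw [hE, Finset.sum_erase_eq_sub (Finset.empty_mem_powerset U), Finset.prod_empty]
  have hprod : ∏ j ∈ U, (1 + w j) ≤ Real.exp (∑ j ∈ U, w j) := by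
    rw [Real.exp_sum]
    exact Finset.prod_le_prod (fun j hj => by linarith [hw j hj]) fun j _ => by linarith [Real.add_one_le_exp (w j)]
  have hem1 : ∀ x : ℝ, Real.exp x - 1 ≤ x * Real.exp x := fun x => by
    have h := mul_le_mul_of_nonneg_right (Real.add_one_le_exp (-x)) (Real.exp_pos x).le
    rw [← Real.exp_add, neg_add_cancel, Real.exp_zero] at h
    nlinarith
  rw [hset]
  linarith [hem1 (∑ j ∈ U, w j)]

/-! ## §2 ONE MEMBER, SEVERAL ANCHORED COMPONENTS: N0w's `memberSum_le_of_anchor` ∘ §1 -/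

section Member

variable {DomK Dom CubeK : Type*} [DecidableEq CubeK] [DecidableEq Dom]

/-- **THE MEMBER BOUND FOR NONEMPTY SETS OF ANCHORED COMPONENTS** (kernel; N0w's `memberSum_le_of_anchor` ONCE BY NAME — its binders
VERBATIM: the components' inner counts `hinner` (N0u's currency, displayed SHAPE), the anchored (1.26)-KIND sums `h126`, the anchor
`hanchor`∕`hA₀`, the (2.36)-KIND transfer `htransfer`, the rate bookkeeping `hκR`∕`hrate` — plus `0 ≤ r`, `0 ≤ R`, composed with §1):
over the NONEMPTY finite sets `T` of labels `⟨Z₀, l⟩` (`cl Z₀ = Z′`, `l ∈ I Z₀`; a component may occur with several labels — a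
LARGER index set than print's, harmless for an upper bound) with weights `Π_{j∈T} ε·m j.1 j.2`,
`Σ_T Π ≤ (A·e^{5R}·e^{A})·e^{−r d(Z′)}·e^{−R(d(Z′)+5)}`, `A := ε·e^{c₀}·A₀·K₀` — print's n ≥ 1 components determining one `Z′_i`
(p. 19–20 KIND), the n = 1 sub-case being N0w's. [folklore] -/
theorem memberSetSum_le_of_anchor {ι : Type*} (S : Finset DomK) (cubesK : DomK → Finset CubeK) (dK : DomK → ℝ)
    (cl : DomK → Dom) (anc : Dom → Finset CubeK) (d : Dom → ℝ) (I : DomK → Finset ι) (m : DomK → ι → ℝ)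
    (hm0 : ∀ Z₀ l, 0 ≤ m Z₀ l) {ε c₀ R₀ κ₀ K₀ A₀ ℓ r R : ℝ} (hε : 0 ≤ ε) (hK₀ : 0 ≤ K₀) (hr : 0 ≤ r) (hR : 0 ≤ R) (Z' : Dom)
    (hd : 0 ≤ d Z')
    (hinner : ∀ Z₀ ∈ S, ∑ l ∈ I Z₀, m Z₀ l ≤ Real.exp c₀ * Real.exp (-(R₀ * dK Z₀)))
    (h126 : ∀ c ∈ anc Z', ∑ Z₀ ∈ S.filter (fun Z₀ => c ∈ cubesK Z₀), Real.exp (-(κ₀ * dK Z₀)) ≤ K₀)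
    (hanchor : ∀ Z₀ ∈ S, cl Z₀ = Z' → ∃ c ∈ anc Z', c ∈ cubesK Z₀) (hA₀ : ((anc Z').card : ℝ) ≤ A₀)
    (htransfer : ∀ Z₀ ∈ S, cl Z₀ = Z' → ℓ * d Z' ≤ dK Z₀) (hκR : κ₀ ≤ R₀) (hrate : r + R ≤ (R₀ - κ₀) * ℓ) :
    ∑ T ∈ ((S.filter (fun Z₀ => cl Z₀ = Z')).sigma I).powerset.filter (fun T => T.Nonempty),
        ∏ j ∈ T, ε * m j.1 j.2 ≤
      (ε * Real.exp c₀ * A₀ * K₀ * Real.exp (5 * R) * Real.exp (ε * Real.exp c₀ * A₀ * K₀)) *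
        Real.exp (-(r * d Z')) * Real.exp (-(R * (d Z' + 5))) := by
  classical
  set U := (S.filter (fun Z₀ => cl Z₀ = Z')).sigma I with hU
  set A := ε * Real.exp c₀ * A₀ * K₀ with hA
  have hA00 : (0 : ℝ) ≤ A₀ := le_trans (Nat.cast_nonneg _) hA₀
  have hApos : 0 ≤ A := mul_nonneg (mul_nonneg (mul_nonneg hε (Real.exp_pos _).le) hA00) hK₀
  -- the single-component sum (N0w's member bound, BY NAME)
  have hx : ∑ j ∈ U, ε * m j.1 j.2 ≤ (A * Real.exp (5 * R)) * Real.exp (-(r * d Z')) * Real.exp (-(R * (d Z' + 5))) :=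
    memberSum_le_of_anchor S cubesK dK cl anc d I m hε hK₀ Z' hd hinner h126 hanchor hA₀ htransfer hκR hrate
  -- its size-free form `x ≤ A`
  have hdec : Real.exp (5 * R) * Real.exp (-(r * d Z')) * Real.exp (-(R * (d Z' + 5))) ≤ 1 := by
    rw [← Real.exp_add, ← Real.exp_add]; exact Real.exp_le_one_iff.2 (by nlinarith)
  have hxA : ∑ j ∈ U, ε * m j.1 j.2 ≤ A := by
    refine hx.trans ?_
    calc A * Real.exp (5 * R) * Real.exp (-(r * d Z')) * Real.exp (-(R * (d Z' + 5)))
        = A * (Real.exp (5 * R) * Real.exp (-(r * d Z')) * Real.exp (-(R * (d Z' + 5)))) := by ring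
      _ ≤ A * 1 := mul_le_mul_of_nonneg_left hdec hApos
      _ = A := mul_one _
  refine (sum_powerset_nonempty_prod_le U (fun j => ε * m j.1 j.2) fun j _ => mul_nonneg hε (hm0 _ _)).trans ?_
  calc (∑ j ∈ U, ε * m j.1 j.2) * Real.exp (∑ j ∈ U, ε * m j.1 j.2)
      ≤ ((A * Real.exp (5 * R)) * Real.exp (-(r * d Z')) * Real.exp (-(R * (d Z' + 5)))) * Real.exp A :=
        mul_le_mul hx (Real.exp_le_exp.2 hxA) (Real.exp_pos _).le (by positivity)
    _ = _ := by ring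

end Member

/-! ## §3 THE END: N0v's outer-label END at SET-VALUED inner data (nonempty sets of anchored components with inner labels) -/

open Metric Set Complex MeasureTheory
open Literature.MathematicalPhysics.QuantumFieldTheory.Balaban1983to89 (LocDomainSys)
open Literature.MathematicalPhysics.QuantumFieldTheory.Balaban1983to89.B13FamilySum (coveringFamilies)
open Literature.MathematicalPhysics.QuantumFieldTheory.Balaban1983to89.T4OutputRate (Carriers)
open Literature.MathematicalPhysics.QuantumFieldTheory.Balaban1983to89.B13Resummation (locE Geometry)
open Summit.QuantumFields.BalabanUV.T4Continuum.B13HistMeasurable (MeasPotFrame B13HistM)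
open Summit.QuantumFields.BalabanUV.T4Continuum.B13TermParamGaussianBi (BiCore)
open Summit.QuantumFields.BalabanUV.T4Continuum.NE1p.DressedSmallFieldOuterCount
  (attachedPart_locE_le_of_coresAt_pencil_outerLabels)

section End

variable {C : Carriers} {P : MeasPotFrame C} {Op : Type*} [NormedAddCommGroup Op] [NormedSpace ℂ Op] {Dk : LocDomainSys}
  {CubeK : Type} [DecidableEq CubeK] {ι₀ : Type}
variable (D : LocDomainSys) {Cube : Type} [DecidableEq Cube] (G : Geometry D Cube) (Gk : Geometry Dk CubeK)
  {𝒴 : ℕ → (Σ _ : Finset Cube, Σ F : Finset D.Dom, ∀ Z ∈ F, Finset (Σ _ : Dk.Dom, ι₀)) → Type*}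
  {dom : ∀ k i, 𝒴 k i → C.Dom}
  {β : ℕ → (Σ _ : Finset Cube, Σ F : Finset D.Dom, ∀ Z ∈ F, Finset (Σ _ : Dk.Dom, ι₀)) → Type*}
  [∀ k i, MeasurableSpace (β k i)]
  {α : ℕ → (Σ _ : Finset Cube, Σ F : Finset D.Dom, ∀ Z ∈ F, Finset (Σ _ : Dk.Dom, ι₀)) → Type*}
  [∀ k i, NormedAddCommGroup (α k i)] [∀ k i, InnerProductSpace ℝ (α k i)] [∀ k i, FiniteDimensional ℝ (α k i)]
  [∀ k i, MeasurableSpace (α k i)] [∀ k i, BorelSpace (α k i)]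

open Classical in
/-- **THE ATTACHED PART FOR CORES INDEXED BY OUTER LABELS WHOSE INNER DATA ARE NONEMPTY SETS OF ANCHORED COMPONENTS WITH INNER
LABELS** (kernel; N0v's `attachedPart_locE_le_of_coresAt_pencil_outerLabels` ONCE BY NAME with inner data
`κ Z′ := Finset (Σ _ : Dk.Dom, ι₀)` — print's components `Z_i`, n ≥ 1 of them determining one `Z′_i`, each with one of its inner
labels —, inner finsets `J Z′ :=` the NONEMPTY subsets of `(univ.filter (cl · = Z′)).sigma I`, weights `Π_{j∈T} ε·m j.1 j.2`, and
`hmember` SUPPLIED by §2's `memberSetSum_le_of_anchor` (N0w's `memberSum_le_of_anchor` ∘ §1).  Binders = N0w's END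
`attachedPart_locE_le_of_coresAt_pencil_components` VERBATIM (`hinner` N0u's SHAPE displayed, `hanchor`∕`hA`, `htransfer`, `hκR`∕
`hrate2`, N0v's `hlink`∕`hRR`, the step clauses, operator letters, class radii), except: `hadm` member-wise with the NONEMPTY-SUBSET
clause, `hAmp`'s majorant `v^{#W′}·Π_{Z′∈F} Π_{j ∈ p Z′} ε·m j.1 j.2`, and N0v's (2.29) clause `h229` at the amplitude
`A·e^{5R}·e^{A}`, `A := ε·e^{c₀}·Aₐ·Gk.K₀` (N0w's `A·e^{5R}` times §1's clause-free `e^{A}`).  Conclusion as N0s's. [folklore] -/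
theorem attachedPart_locE_le_of_coresAt_pencil_componentSets {Win : Set (ℕ → ℝ)}
    {ctr : ℕ → (ℕ → ℝ) → C.BgB → Op × B13HistM P} {ROp RHist R' : ℕ → ℝ}
    (𝔊 : ∀ k i, C.Dom → BiCore P (dom k i) Op (β k i) (α k i))
    {mq bq N₀ : ℕ → (Σ _ : Finset Cube, Σ F : Finset D.Dom, ∀ Z ∈ F, Finset (Σ _ : Dk.Dom, ι₀)) → C.Dom → ℝ}
    (hroom : ∀ k, ROp k < R' k)
    (hm : ∀ k, ∀ g ∈ Win, ∀ (U : C.BgB) (X : C.Dom), C.scale X = k → ∀ i, 0 < mq k i X)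
    (hN : ∀ k, ∀ g ∈ Win, ∀ (U : C.BgB) (X : C.Dom), C.scale X = k → ∀ i,
      (∀ o ∈ ball (ctr k g U).1 (R' k), AEStronglyMeasurable ((𝔊 k i X).N o) (𝔊 k i X).lam) ∧
      (∀ p, DifferentiableOn ℂ (fun o => (𝔊 k i X).N o p) (ball (ctr k g U).1 (R' k))) ∧
      (∀ o ∈ ball (ctr k g U).1 (R' k), ∀ p, ‖(𝔊 k i X).N o p‖ ≤ N₀ k i X))
    (hq : ∀ k, ∀ g ∈ Win, ∀ (U : C.BgB) (X : C.Dom), C.scale X = k → ∀ i,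
      (∀ o ∈ ball (ctr k g U).1 (R' k),
        AEStronglyMeasurable (Function.uncurry ((𝔊 k i X).q o)) ((𝔊 k i X).lam.prod volume)) ∧
      (∀ p v, DifferentiableOn ℂ (fun o => (𝔊 k i X).q o p v) (ball (ctr k g U).1 (R' k))) ∧
      (∀ o ∈ ball (ctr k g U).1 (R' k), ∀ p v, mq k i X * ‖v‖ ^ 2 - bq k i X ≤ ((𝔊 k i X).q o p v).re))
    {k : ℕ} {g : ℕ → ℝ} (hg : g ∈ Win) {U : C.BgB} {o : Op} {h₀ w : B13HistM P} {ϱ : ℝ}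
    (hO : ‖o - (ctr k g U).1‖ ≤ ROp k) (hH : ‖h₀ - (ctr k g U).2‖ + ϱ * ‖w‖ ≤ RHist k)
    {emb : D.Dom → C.Dom} (hscale : ∀ Z, C.scale (emb Z) = k)
    {terms : D.Dom → Finset (Σ _ : Finset Cube, Σ F : Finset D.Dom, ∀ Z ∈ F, Finset (Σ _ : Dk.Dom, ι₀))}
    {act : ℂ → D.Dom → ℂ}
    (hact : ∀ σ ∈ ball (0 : ℂ) ϱ, ∀ Z, act σ Z = ∑ i ∈ terms Z, (𝔊 k i (emb Z)).termAt o (h₀ + σ • w))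
    {A₀ A₁ Rkp r₁ b₅ : ℝ} {X₀ : D.Dom} (hA₀ : 0 ≤ A₀) (hA₁ : 0 ≤ A₁) (hr₁ : 0 ≤ r₁) (hb : r₁ * 5 ≤ b₅)
    (hrate : r₁ + 2 * G.κ₀ + 2 ≤ Rkp) (hsmall : (A₀ + ϱ * A₁) * Real.exp (b₅ + 1) * G.K₀ * G.ν * G.c₁ ≤ 1)
    -- the inner data of the components (N0u's currency, displayed SHAPE) and the anchored closure (N0w's letters VERBATIM)
    (I : Dk.Dom → Finset ι₀) (m : Dk.Dom → ι₀ → ℝ) (hm0 : ∀ Z₀ l, 0 ≤ m Z₀ l) (cl : Dk.Dom → D.Dom)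
    (anc : D.Dom → Finset CubeK) {ε c₀ R₀ Aₐ ℓ r R c' v : ℝ} (hε : 0 ≤ ε) (hv : 0 ≤ v)
    (hinner : ∀ Z₀, ∑ l ∈ I Z₀, m Z₀ l ≤ Real.exp c₀ * Real.exp (-(R₀ * Dk.dj Z₀)))
    (hanchor : ∀ Z₀ Z', cl Z₀ = Z' → ∃ c ∈ anc Z', c ∈ Gk.cubes Z₀) (hA : ∀ Z', ((anc Z').card : ℝ) ≤ Aₐ)
    (htransfer : ∀ Z₀ Z', cl Z₀ = Z' → ℓ * D.dj Z' ≤ Dk.dj Z₀) (hκR : Gk.κ₀ ≤ R₀) (hrate2 : r + R ≤ (R₀ - Gk.κ₀) * ℓ)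
    (hκ : G.κ₀ + 1 ≤ r)
    (h229 : Real.exp 1 * G.K₀ * G.c₁ * (ε * Real.exp c₀ * Aₐ * Gk.K₀ * Real.exp (5 * R) *
      Real.exp (ε * Real.exp c₀ * Aₐ * Gk.K₀)) ≤ 1)
    (hlink : ∀ Z, ∀ W ⊆ G.cubes Z, ∀ F ∈ coveringFamilies Finset.univ G.cubes (G.cubes Z \ W),
      D.dj Z - c' * W.card + 5 ≤ ∑ Z' ∈ F, (D.dj Z' + 5))
    (hRR : Rkp ≤ R - G.c₁ * (v * Real.exp (R * c')))
    (hadm : ∀ Z, ∀ l ∈ terms Z, l.1 ⊆ G.cubes Z ∧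
      l.2.1 ∈ coveringFamilies Finset.univ G.cubes (G.cubes Z \ l.1) ∧
      ∀ Z' (h : Z' ∈ l.2.1), (l.2.2 Z' h).Nonempty ∧
        l.2.2 Z' h ⊆ ((Finset.univ : Finset Dk.Dom).filter (fun Z₀ => cl Z₀ = Z')).sigma I)
    (hAmp : ∀ Z, G.cubes Z ⊆ G.cubes X₀ → ∀ l ∈ terms Z,
      (𝔊 k l (emb Z)).lam.real univ * ((𝔊 k l (emb Z)).wB * N₀ k l (emb Z) * Real.exp (bq k l (emb Z))) *
          (Real.pi / (mq k l (emb Z) / 2)) ^ (Module.finrank ℝ (α k l) / 2 : ℝ) *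
        Real.exp ((𝔊 k l (emb Z)).N₁ * (‖h₀‖ + ϱ * ‖w‖)) ≤
      (A₀ + ϱ * A₁) * (v ^ l.1.card * ∏ x ∈ l.2.1.attach, ∏ j ∈ l.2.2 x.1 x.2, ε * m j.1 j.2))
    (hϱ : 2 ≤ ϱ) (hϱA : A₀ ≤ ϱ * A₁) :
    ‖locE G.ι G.cubes (act 1) (G.cubes X₀) - locE G.ι G.cubes (act 0) (G.cubes X₀)‖ ≤
      4 * (Real.exp 1 * G.ν * G.c₁ * G.K₀ ^ 2) * A₁ * Real.exp (-(r₁ * D.dj X₀)) := by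
  -- `0 ≤ Aₐ`, `0 ≤ a`, `0 ≤ r`, `0 ≤ R` FOLLOW from the clauses (`hA` at `X₀`; `hκ`; `hrate`∕`hRR` as in N0v)
  have hA0 : (0 : ℝ) ≤ Aₐ := le_trans (Nat.cast_nonneg _) (hA X₀)
  have ha : 0 ≤ ε * Real.exp c₀ * Aₐ * Gk.K₀ * Real.exp (5 * R) * Real.exp (ε * Real.exp c₀ * Aₐ * Gk.K₀) :=
    mul_nonneg (mul_nonneg (mul_nonneg (mul_nonneg (mul_nonneg hε (Real.exp_pos _).le) hA0) Gk.K₀_nonneg)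
      (Real.exp_pos _).le) (Real.exp_pos _).le
  have hr : 0 ≤ r := by linarith [G.κ₀_nonneg]
  have hcu : 0 ≤ G.c₁ * (v * Real.exp (R * c')) := mul_nonneg G.c₁_nonneg (by positivity)
  have hR : 0 ≤ R := by linarith [G.κ₀_nonneg]
  exact attachedPart_locE_le_of_coresAt_pencil_outerLabels D G 𝔊 hroom hm hN hq hg hO hH hscale hact hA₀ hA₁ hr₁ hb hrate hsmall
    (fun Z' => (((Finset.univ : Finset Dk.Dom).filter (fun Z₀ => cl Z₀ = Z')).sigma I).powerset.filter fun T => T.Nonempty)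
    (fun _ T => ∏ j ∈ T, ε * m j.1 j.2) (fun _ T => Finset.prod_nonneg fun j _ => mul_nonneg hε (hm0 _ _)) ha hv hκ h229
    (fun Z' => memberSetSum_le_of_anchor Finset.univ Gk.cubes Dk.dj cl anc D.dj I m hm0 hε Gk.K₀_nonneg hr hR Z' (D.dj_nonneg Z')
      (fun Z₀ _ => hinner Z₀) (fun c _ => Gk.ineq126 c) (fun Z₀ _ h => hanchor Z₀ Z' h) (hA Z')
      (fun Z₀ _ h => htransfer Z₀ Z' h) hκR hrate2)
    hlink hRR
    (fun Z l hl => ⟨(hadm Z l hl).1, (hadm Z l hl).2.1, fun Z' h =>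
      Finset.mem_filter.2 ⟨Finset.mem_powerset.2 ((hadm Z l hl).2.2 Z' h).2, ((hadm Z l hl).2.2 Z' h).1⟩⟩)
    hAmp hϱ hϱA

end End

end Summit.QuantumFields.BalabanUV.T4Continuum.NE1p.DressedSmallFieldComponentSets

end
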